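import Literature.MathematicalPhysics.QuantumFieldTheory.TphiSeminorm
import Mathlib.Analysis.SpecialFunctions.ExpDeriv
import Mathlib.Analysis.Calculus.Deriv.MeanValue
import Mathlib.Analysis.Calculus.Deriv.Pow
import Mathlib.Analysis.Normed.Operator.Mul
import HarnessLib

/-!
# The `T_φ`-seminorm of an exponential: `‖e^F‖_{T_φ} ≤ ‖e^{F(φ)}‖ · e^{‖F‖_{T_φ} - ‖F(φ)‖}`

Bauerschmidt–Brydges–Slade 2019, Lemma 7.4.1: for a real function `F` of the field,
`‖e^{F}‖_{T_φ} ≤ e^{F(φ) + (‖F‖_{T_φ} - |F(φ)|)}` — the estimate by which the renormalisation group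
controls `e^{-V}` ("stability") in the `T_φ`-seminorm (`TphiSeminorm.lean`). We prove it in a form
that also covers COMPLEX-valued `F` (complex activities): for `G = e^F` with `F : E → ℂ` (or `ℝ`),

  `‖G‖_{T_φ(𝔥)} ≤ ‖G(φ)‖ · exp(‖F‖_{T_φ(𝔥)} - ‖F(φ)‖)`,  `‖e^{F(φ)}‖ = e^{Re F(φ)}`

(`tphiSeminorm_cexp_le`, `tphiSeminorm_exp_le`; BBS's real statement is `tphiSeminorm_exp_le`, and
the cruder `‖e^F‖_{T_φ} ≤ e^{‖F‖_{T_φ}}` of BBS (7.1.4) is `tphiSeminorm_cexp_le_exp` /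
`tphiSeminorm_exp_le_exp`).

Proof (truncation-friendly, no power series): from `D e^F = e^F · DF` and the Leibniz bound,
`‖D^{n+1}e^F(φ)‖ ≤ ∑_{i ≤ n} C(n,i) ‖D^i e^F(φ)‖ ‖D^{n+1-i}F(φ)‖`, so `‖Dⁿe^F(φ)‖ ≤ ‖e^{F(φ)}‖ uₙ` for
the **Bell majorant** `u₀ = 1`, `u_{n+1} = ∑_{i≤n} C(n,i) uᵢ f_{n+1-i}`, `f_k = ‖DᵏF(φ)‖`
(`norm_iteratedFDeriv_le_bellMajorant`, stated abstractly for any pair with `DG = G·DF`); and the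
generating inequality `∑_{n≤N} uₙ 𝔥ⁿ/n! ≤ exp(∑_{1≤k≤N} f_k 𝔥ᵏ/k!)` (`sum_bellMajorant_le_exp`) holds
because `S(t) = ∑_{n ≤ N} uₙtⁿ/n!` obeys `S' ≤ S g'` for `g(t) = ∑_{1≤k≤N} f_k tᵏ/k!` (the rearrangement
`sum_choose_weighted_le_mul` of the product property), whence `S e^{-g}` is non-increasing (Grönwall).

## References

* R. Bauerschmidt, D. C. Brydges, G. Slade, *Introduction to a Renormalisation Group Method*,
  LNM 2242 (2019), Lemma 7.4.1, Prop. 7.4.2, (7.1.4). [BauerschmidtBrydgesSlade2019RG]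
* D. C. Brydges, G. Slade, *A renormalisation group method. I*, J. Stat. Phys. 159 (2015),
  Prop. 3.8 ff. (norms of exponentials in normed algebras of functionals). [BrydgesSlade2015I]
-/

noncomputable section

namespace Literature.MathematicalPhysics.QuantumFieldTheory

open Finset Set
open scoped Nat

/-! ### The Bell majorant sequence -/

/-- **The Bell majorant** of a sequence `f`: `u₀ = 1`, `u_{n+1} = ∑_{i ≤ n} C(n,i) uᵢ f_{n+1-i}` — the
derivatives at `0` of `exp(∑_{k ≥ 1} f_k tᵏ/k!)` (complete Bell polynomials in `f₁, f₂, …`). [folklore] -/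
def bellMajorant (f : ℕ → ℝ) : ℕ → ℝ
  | 0 => 1
  | n + 1 => ∑ i : Fin (n + 1), (n.choose (i : ℕ) : ℝ) * bellMajorant f i * f (n + 1 - i)

/-- `u₀ = 1`. [folklore] -/
@[simp] theorem bellMajorant_zero (f : ℕ → ℝ) : bellMajorant f 0 = 1 := by
  rw [bellMajorant]

/-- The recursion `u_{n+1} = ∑_{i ≤ n} C(n,i) uᵢ f_{n+1-i}`. [folklore] -/
theorem bellMajorant_succ (f : ℕ → ℝ) (n : ℕ) :
    bellMajorant f (n + 1) = ∑ i ∈ range (n + 1), (n.choose i : ℝ) * bellMajorant f i * f (n + 1 - i) := by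
  rw [bellMajorant]
  exact Fin.sum_univ_eq_sum_range (fun i => (n.choose i : ℝ) * bellMajorant f i * f (n + 1 - i)) (n + 1)

/-- The Bell majorant of a nonnegative sequence is nonnegative. [folklore] -/
theorem bellMajorant_nonneg {f : ℕ → ℝ} (hf : ∀ k, 0 ≤ f k) : ∀ n, 0 ≤ bellMajorant f n := by
  intro n
  induction n using Nat.strong_induction_on with
  | _ n ih =>
    rcases n with _ | n
    · simp
    · rw [bellMajorant_succ]
      exact sum_nonneg fun i hi =>
        mul_nonneg (mul_nonneg (by positivity) (ih i (mem_range.1 hi))) (hf _)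

/-! ### Derivatives of `G` with `DG = G · DF` are dominated by the Bell majorant -/

section Deriv

variable {E : Type*} [NormedAddCommGroup E] [NormedSpace ℝ E]
variable {A : Type*} [NormedRing A] [NormedAlgebra ℝ A]

set_option maxSynthPendingDepth 2 in -- operator norm on the triply nested `A →L (E →L A) →L (E →L A)`
/-- **Exponential-type derivative bound**: if `DG = G · DF` (e.g. `G = e^F`) with `F, G` of class
`C^N`, then `‖DⁿG(φ)‖ ≤ ‖G(φ)‖ · uₙ` for the Bell majorant `u` of `f_k = ‖DᵏF(φ)‖`, `n ≤ N`. [cite: BauerschmidtBrydgesSlade2019RG, Lemma 7.4.1] -/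
theorem norm_iteratedFDeriv_le_bellMajorant {F G : E → A} {N : ℕ} (hF : ContDiff ℝ N F) (hG : ContDiff ℝ N G)
    (hGF : ∀ x, fderiv ℝ G x = (ContinuousLinearMap.mul ℝ A (G x)).comp (fderiv ℝ F x)) (φ : E) :
    ∀ n, n ≤ N → ‖iteratedFDeriv ℝ n G φ‖ ≤ ‖G φ‖ * bellMajorant (fun k => ‖iteratedFDeriv ℝ k F φ‖) n := by
  intro n
  induction n using Nat.strong_induction_on with
  | _ n ih =>
    intro hn
    rcases n with _ | m
    · simp [norm_iteratedFDeriv_zero]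
    · -- `‖D^{m+1}G‖ = ‖D^m (DG)‖ = ‖D^m (B(G, DF))‖`
      set B : A →L[ℝ] (E →L[ℝ] A) →L[ℝ] (E →L[ℝ] A) :=
        (ContinuousLinearMap.compL ℝ E A A).comp (ContinuousLinearMap.mul ℝ A) with hB
      have hBn : ‖B‖ ≤ 1 := by
        refine (ContinuousLinearMap.opNorm_comp_le _ _).trans ?_
        have h1 := ContinuousLinearMap.norm_compL_le (𝕜 := ℝ) (E := E) (Fₗ := A) (Gₗ := A)
        have h2 := ContinuousLinearMap.opNorm_mul_le ℝ A
        nlinarith [norm_nonneg (ContinuousLinearMap.compL ℝ E A A), norm_nonneg (ContinuousLinearMap.mul ℝ A)]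
      have hfd : fderiv ℝ G = fun y => B (G y) (fderiv ℝ F y) := by
        funext y; rw [hGF y]; rfl
      have hmN : (m : WithTop ℕ∞) + 1 ≤ (N : WithTop ℕ∞) := by exact_mod_cast hn
      have hGm : ContDiff ℝ m G := hG.of_le (by exact_mod_cast (Nat.le_of_succ_le hn))
      have hFm : ContDiff ℝ m (fderiv ℝ F) := hF.fderiv_right hmN
      rw [← norm_iteratedFDeriv_fderiv, hfd]
      refine (B.norm_iteratedFDeriv_le_of_bilinear_of_le_one hGm hFm φ le_rfl hBn).trans ?_
      rw [bellMajorant_succ, mul_sum]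
      refine sum_le_sum fun i hi => ?_
      have him : i ≤ m := Nat.lt_succ_iff.1 (mem_range.1 hi)
      have h1 := ih i (Nat.lt_succ_of_le him) (by omega)
      rw [norm_iteratedFDeriv_fderiv, show m - i + 1 = m + 1 - i by omega]
      have h2 : 0 ≤ ‖iteratedFDeriv ℝ (m + 1 - i) F φ‖ := norm_nonneg _
      calc (m.choose i : ℝ) * ‖iteratedFDeriv ℝ i G φ‖ * ‖iteratedFDeriv ℝ (m + 1 - i) F φ‖
          ≤ (m.choose i : ℝ) * (‖G φ‖ * bellMajorant (fun k => ‖iteratedFDeriv ℝ k F φ‖) i) *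
              ‖iteratedFDeriv ℝ (m + 1 - i) F φ‖ := by gcongr
        _ = ‖G φ‖ * ((m.choose i : ℝ) * bellMajorant (fun k => ‖iteratedFDeriv ℝ k F φ‖) i *
              ‖iteratedFDeriv ℝ (m + 1 - i) F φ‖) := by ring

end Deriv

/-! ### The generating inequality `∑ uₙ 𝔥ⁿ/n! ≤ exp(∑ f_k 𝔥ᵏ/k!)` -/

/-- Derivative of a truncated exponential-type sum: `(∑_{n ≤ N} cₙ tⁿ/n!)' = ∑_{n < N} c_{n+1} tⁿ/n!`. [folklore] -/
theorem hasDerivAt_sum_pow_div_factorial (c : ℕ → ℝ) (N : ℕ) (t : ℝ) :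
    HasDerivAt (fun t => ∑ n ∈ range (N + 1), c n * t ^ n / (n ! : ℝ))
      (∑ n ∈ range N, c (n + 1) * t ^ n / (n ! : ℝ)) t := by
  induction N with
  | zero =>
    simp only [zero_add, range_one, sum_singleton, pow_zero, Nat.factorial_zero, Nat.cast_one, div_one,
      mul_one, range_zero, sum_empty]
    exact hasDerivAt_const t (c 0)
  | succ N ih =>
    have hmono : HasDerivAt (fun t : ℝ => c (N + 1) * t ^ (N + 1) / ((N + 1)! : ℝ))
        (c (N + 1) * t ^ N / (N ! : ℝ)) t := by
      have h := ((hasDerivAt_pow (N + 1) t).const_mul (c (N + 1))).div_const ((N + 1)! : ℝ)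
      refine h.congr_deriv ?_
      rw [Nat.factorial_succ]
      push_cast
      have hN : (N ! : ℝ) ≠ 0 := by positivity
      have hN1 : ((N : ℝ) + 1) ≠ 0 := by positivity
      field_simp
    have hsum := ih.add hmono
    have e1 : (fun t : ℝ => ∑ n ∈ range (N + 1 + 1), c n * t ^ n / (n ! : ℝ)) =
        fun t => (∑ n ∈ range (N + 1), c n * t ^ n / (n ! : ℝ)) + c (N + 1) * t ^ (N + 1) / ((N + 1)! : ℝ) := by
      funext s; rw [sum_range_succ]
    rw [e1, sum_range_succ]
    exact hsum

/-- **The generating inequality**: for nonnegative `f` and `𝔥 ≥ 0`,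
`∑_{n ≤ N} uₙ 𝔥ⁿ/n! ≤ exp(∑_{1 ≤ k ≤ N} f_k 𝔥ᵏ/k!)` for the Bell majorant `u` of `f`
(equality for `N = ∞`; Grönwall on `S' ≤ S g'`). [cite: BauerschmidtBrydgesSlade2019RG, Prop. 7.4.2] -/
theorem sum_bellMajorant_le_exp {f : ℕ → ℝ} (hf : ∀ k, 0 ≤ f k) (N : ℕ) {𝔥 : ℝ} (h𝔥 : 0 ≤ 𝔥) :
    ∑ n ∈ range (N + 1), bellMajorant f n * 𝔥 ^ n / (n ! : ℝ) ≤
      Real.exp (∑ k ∈ range N, f (k + 1) * 𝔥 ^ (k + 1) / ((k + 1)! : ℝ)) := by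
  rcases N with _ | M
  · simp
  -- the truncated generating function `S`, its derivative `S'`, the exponent `g` and `g'`
  set u := bellMajorant f with hu
  set c : ℕ → ℝ := fun n => if n = 0 then 0 else f n with hc
  set S : ℝ → ℝ := fun t => ∑ n ∈ range (M + 1 + 1), u n * t ^ n / (n ! : ℝ) with hS
  set S' : ℝ → ℝ := fun t => ∑ n ∈ range (M + 1), u (n + 1) * t ^ n / (n ! : ℝ) with hS'
  set g : ℝ → ℝ := fun t => ∑ n ∈ range (M + 1 + 1), c n * t ^ n / (n ! : ℝ) with hg
  set g' : ℝ → ℝ := fun t => ∑ n ∈ range (M + 1), f (n + 1) * t ^ n / (n ! : ℝ) with hg'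
  have hSd : ∀ t, HasDerivAt S (S' t) t := fun t => hasDerivAt_sum_pow_div_factorial u (M + 1) t
  have hgd : ∀ t, HasDerivAt g (g' t) t := by
    intro t
    have h := hasDerivAt_sum_pow_div_factorial c (M + 1) t
    have e : (∑ n ∈ range (M + 1), c (n + 1) * t ^ n / (n ! : ℝ)) = g' t :=
      sum_congr rfl fun n _ => by simp [hc]
    rw [e] at h
    exact h
  -- `g` is the exponent in the statement
  have hg_eq : ∀ t, g t = ∑ k ∈ range (M + 1), f (k + 1) * t ^ (k + 1) / ((k + 1)! : ℝ) := by
    intro t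
    simp only [hg]
    rw [sum_range_succ']
    simp [hc]
  -- nonnegativity facts on `t ≥ 0`
  have hun : ∀ n, 0 ≤ u n := bellMajorant_nonneg hf
  have hg'n : ∀ t, 0 ≤ t → 0 ≤ g' t := fun t ht => sum_nonneg fun n _ => by
    have := hf (n + 1); positivity
  have hSn : ∀ t, 0 ≤ t → 0 ≤ S t := fun t ht => sum_nonneg fun n _ => by
    have := hun n; positivity
  -- the key differential inequality `S' ≤ S g'` on `t ≥ 0`
  have hkey : ∀ t, 0 ≤ t → S' t ≤ S t * g' t := by
    intro t ht
    -- `S'(t) = ∑_{n ≤ M} (tⁿ/n!) ∑_{i ≤ n} C(n,i) uᵢ f_{n+1-i}`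
    have e1 : S' t = ∑ n ∈ range (M + 1), t ^ n / (n ! : ℝ) *
        ∑ i ∈ range (n + 1), (n.choose i : ℝ) * u i * f (n - i + 1) := by
      simp only [hS']
      refine sum_congr rfl fun n hn => ?_
      rw [hu, bellMajorant_succ, ← hu, mul_div_assoc, mul_comm]
      congr 1
      refine sum_congr rfl fun i hi => ?_
      have : i ≤ n := Nat.lt_succ_iff.1 (mem_range.1 hi)
      rw [show n + 1 - i = n - i + 1 by omega]
    have e2 := sum_choose_weighted_le_mul M ht (a := u) (b := fun j => f (j + 1)) hun (fun j => hf _)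
    have e3 : (∑ i ∈ range (M + 1), t ^ i / (i ! : ℝ) * u i) ≤ S t := by
      have hSt : S t = (∑ i ∈ range (M + 1), u i * t ^ i / (i ! : ℝ)) + u (M + 1) * t ^ (M + 1) / ((M + 1)! : ℝ) := by
        simp only [hS]; rw [sum_range_succ]
      have hlast : 0 ≤ u (M + 1) * t ^ (M + 1) / ((M + 1)! : ℝ) := by have := hun (M + 1); positivity
      have hre : ∑ i ∈ range (M + 1), t ^ i / (i ! : ℝ) * u i = ∑ i ∈ range (M + 1), u i * t ^ i / (i ! : ℝ) :=
        sum_congr rfl fun i _ => by ring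
      rw [hSt, hre]
      linarith
    have e4 : (∑ j ∈ range (M + 1), t ^ j / (j ! : ℝ) * f (j + 1)) = g' t := by
      simp only [hg']
      exact sum_congr rfl fun j _ => by ring
    rw [e1]
    calc _ ≤ (∑ i ∈ range (M + 1), t ^ i / (i ! : ℝ) * u i) * (∑ j ∈ range (M + 1), t ^ j / (j ! : ℝ) * f (j + 1)) := e2
      _ ≤ S t * g' t := by
          rw [e4]
          exact mul_le_mul_of_nonneg_right e3 (hg'n t ht)
  -- Grönwall: `ψ = S e^{-g}` is non-increasing on `[0, ∞)`
  set ψ : ℝ → ℝ := fun t => S t * Real.exp (-g t) with hψ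
  have hψd : ∀ t, HasDerivAt ψ ((S' t - S t * g' t) * Real.exp (-g t)) t := by
    intro t
    have h1 := (hSd t).mul (((hgd t).neg).exp)
    refine h1.congr_deriv ?_
    simp only [Pi.neg_apply]
    ring
  have hanti : AntitoneOn ψ (Ici 0) := by
    have hmono : MonotoneOn (fun t => -ψ t) (Ici 0) := by
      refine monotoneOn_of_hasDerivWithinAt_nonneg (convex_Ici 0) ?_ ?_ ?_ (f' := fun t => -((S' t - S t * g' t) * Real.exp (-g t)))
      · exact (continuous_neg.comp (continuous_iff_continuousAt.2 fun t => (hψd t).continuousAt)).continuousOn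
      · intro t _
        exact ((hψd t).neg).hasDerivWithinAt
      · intro t ht
        rw [interior_Ici] at ht
        have hk := hkey t (le_of_lt ht)
        have : (S' t - S t * g' t) * Real.exp (-g t) ≤ 0 :=
          mul_nonpos_of_nonpos_of_nonneg (by linarith) (Real.exp_pos _).le
        linarith
    intro a ha b hb hab
    have := hmono ha hb hab
    simp only [neg_le_neg_iff] at this
    exact this
  have hS0 : S 0 = 1 := by
    simp only [hS]
    rw [sum_eq_single 0 (fun n _ hn => by simp [zero_pow hn]) (by simp)]
    simp [hu]
  have hg0 : g 0 = 0 := by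
    simp only [hg]
    exact sum_eq_zero fun n _ => by
      rcases Nat.eq_zero_or_pos n with rfl | hn
      · simp [hc]
      · simp [zero_pow hn.ne']
  have hψ0 : ψ 0 = 1 := by
    simp only [hψ]
    rw [hS0, hg0, neg_zero, Real.exp_zero, mul_one]
  have hψh : ψ 𝔥 ≤ 1 := by rw [← hψ0]; exact hanti (mem_Ici.2 le_rfl) (mem_Ici.2 h𝔥) h𝔥
  -- conclude
  have hfinal : S 𝔥 ≤ Real.exp (g 𝔥) := by
    have hpos := Real.exp_pos (-g 𝔥)
    have h1 : S 𝔥 * Real.exp (-g 𝔥) ≤ 1 := hψh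
    rw [Real.exp_neg] at h1
    rw [mul_inv_le_iff₀ (Real.exp_pos _)] at h1
    linarith
  rw [← hg_eq 𝔥]
  exact hfinal

/-! ### The `T_φ`-seminorm of `G` with `DG = G·DF` -/

section Tphi

variable {E : Type*} [NormedAddCommGroup E] [NormedSpace ℝ E]
variable {A : Type*} [NormedRing A] [NormedAlgebra ℝ A]

/-- **Abstract exponential bound**: if `DG = G · DF` with `F, G` of class `C^N`, then
`‖G‖_{T_φ(𝔥)} ≤ ‖G(φ)‖ · exp(‖F‖_{T_φ(𝔥)} - ‖F(φ)‖)` (Taylor order `N`). [cite: BauerschmidtBrydgesSlade2019RG, Lemma 7.4.1] -/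
theorem tphiSeminorm_le_of_fderiv_eq_mul (N : ℕ) {𝔥 : ℝ} (h𝔥 : 0 ≤ 𝔥) {F G : E → A} (hF : ContDiff ℝ N F)
    (hG : ContDiff ℝ N G) (hGF : ∀ x, fderiv ℝ G x = (ContinuousLinearMap.mul ℝ A (G x)).comp (fderiv ℝ F x))
    (φ : E) :
    tphiSeminorm N 𝔥 G φ ≤ ‖G φ‖ * Real.exp (tphiSeminorm N 𝔥 F φ - ‖F φ‖) := by
  set f : ℕ → ℝ := fun k => ‖iteratedFDeriv ℝ k F φ‖ with hf
  have hfn : ∀ k, 0 ≤ f k := fun k => norm_nonneg _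
  have hmaj := norm_iteratedFDeriv_le_bellMajorant hF hG hGF φ
  calc tphiSeminorm N 𝔥 G φ
      = ∑ n ∈ range (N + 1), 𝔥 ^ n / (n ! : ℝ) * ‖iteratedFDeriv ℝ n G φ‖ := rfl
    _ ≤ ∑ n ∈ range (N + 1), 𝔥 ^ n / (n ! : ℝ) * (‖G φ‖ * bellMajorant f n) :=
        sum_le_sum fun n hn => mul_le_mul_of_nonneg_left (hmaj n (Nat.lt_succ_iff.1 (mem_range.1 hn)))
          (by positivity)
    _ = ‖G φ‖ * ∑ n ∈ range (N + 1), bellMajorant f n * 𝔥 ^ n / (n ! : ℝ) := by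
        rw [mul_sum]; exact sum_congr rfl fun n _ => by ring
    _ ≤ ‖G φ‖ * Real.exp (∑ k ∈ range N, f (k + 1) * 𝔥 ^ (k + 1) / ((k + 1)! : ℝ)) :=
        mul_le_mul_of_nonneg_left (sum_bellMajorant_le_exp hfn N h𝔥) (norm_nonneg _)
    _ = ‖G φ‖ * Real.exp (tphiSeminorm N 𝔥 F φ - ‖F φ‖) := by
        congr 2
        rw [tphiSeminorm_eq_norm_add, add_sub_cancel_left]
        exact sum_congr rfl fun k _ => by simp only [hf]; ring

/-- **`‖e^F‖_{T_φ}` for complex `F`**: `‖e^F‖_{T_φ(𝔥)} ≤ e^{Re F(φ)} · e^{‖F‖_{T_φ(𝔥)} - |F(φ)|}`.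
[cite: BauerschmidtBrydgesSlade2019RG, Lemma 7.4.1] -/
theorem tphiSeminorm_cexp_le (N : ℕ) {𝔥 : ℝ} (h𝔥 : 0 ≤ 𝔥) {F : E → ℂ} (hF : ContDiff ℝ N F) (φ : E) :
    tphiSeminorm N 𝔥 (fun x => Complex.exp (F x)) φ ≤
      Real.exp (F φ).re * Real.exp (tphiSeminorm N 𝔥 F φ - ‖F φ‖) := by
  rcases Nat.eq_zero_or_pos N with rfl | hN
  · rw [tphiSeminorm_zero_order, tphiSeminorm_zero_order, Complex.norm_exp, sub_self, Real.exp_zero, mul_one]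
  have hdiff : Differentiable ℝ F := hF.differentiable (by exact_mod_cast hN.ne')
  have hGF : ∀ x, fderiv ℝ (fun x => Complex.exp (F x)) x =
      (ContinuousLinearMap.mul ℝ ℂ (Complex.exp (F x))).comp (fderiv ℝ F x) := by
    intro x
    rw [(hdiff x).hasFDerivAt.cexp.fderiv]
    ext v
    simp
  have h := tphiSeminorm_le_of_fderiv_eq_mul N h𝔥 hF hF.cexp hGF φ
  rwa [Complex.norm_exp] at h

/-- The cruder form `‖e^F‖_{T_φ} ≤ e^{‖F‖_{T_φ}}` for complex `F`. [cite: BauerschmidtBrydgesSlade2019RG, (7.1.4)] -/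
theorem tphiSeminorm_cexp_le_exp (N : ℕ) {𝔥 : ℝ} (h𝔥 : 0 ≤ 𝔥) {F : E → ℂ} (hF : ContDiff ℝ N F) (φ : E) :
    tphiSeminorm N 𝔥 (fun x => Complex.exp (F x)) φ ≤ Real.exp (tphiSeminorm N 𝔥 F φ) := by
  refine (tphiSeminorm_cexp_le N h𝔥 hF φ).trans ?_
  rw [← Real.exp_add]
  refine Real.exp_le_exp.2 ?_
  have : (F φ).re ≤ ‖F φ‖ := Complex.re_le_norm _
  linarith

/-- **BBS Lemma 7.4.1 (real `F`)**: `‖e^F‖_{T_φ(𝔥)} ≤ e^{F(φ) + (‖F‖_{T_φ(𝔥)} - |F(φ)|)}`.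
[cite: BauerschmidtBrydgesSlade2019RG, Lemma 7.4.1] -/
theorem tphiSeminorm_exp_le (N : ℕ) {𝔥 : ℝ} (h𝔥 : 0 ≤ 𝔥) {F : E → ℝ} (hF : ContDiff ℝ N F) (φ : E) :
    tphiSeminorm N 𝔥 (fun x => Real.exp (F x)) φ ≤ Real.exp (F φ + (tphiSeminorm N 𝔥 F φ - |F φ|)) := by
  rcases Nat.eq_zero_or_pos N with rfl | hN
  · rw [tphiSeminorm_zero_order, tphiSeminorm_zero_order, Real.norm_eq_abs, Real.norm_eq_abs,
      Real.abs_exp, sub_self, add_zero]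
  have hdiff : Differentiable ℝ F := hF.differentiable (by exact_mod_cast hN.ne')
  have hGF : ∀ x, fderiv ℝ (fun x => Real.exp (F x)) x =
      (ContinuousLinearMap.mul ℝ ℝ (Real.exp (F x))).comp (fderiv ℝ F x) := by
    intro x
    rw [(hdiff x).hasFDerivAt.exp.fderiv]
    ext v
    simp
  have h := tphiSeminorm_le_of_fderiv_eq_mul N h𝔥 hF hF.exp hGF φ
  rw [Real.norm_eq_abs, Real.abs_exp, Real.norm_eq_abs, ← Real.exp_add] at h
  exact h

/-- The cruder form `‖e^F‖_{T_φ} ≤ e^{‖F‖_{T_φ}}` for real `F`. [cite: BauerschmidtBrydgesSlade2019RG, (7.1.4)] -/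
theorem tphiSeminorm_exp_le_exp (N : ℕ) {𝔥 : ℝ} (h𝔥 : 0 ≤ 𝔥) {F : E → ℝ} (hF : ContDiff ℝ N F) (φ : E) :
    tphiSeminorm N 𝔥 (fun x => Real.exp (F x)) φ ≤ Real.exp (tphiSeminorm N 𝔥 F φ) := by
  refine (tphiSeminorm_exp_le N h𝔥 hF φ).trans (Real.exp_le_exp.2 ?_)
  have : F φ ≤ |F φ| := le_abs_self _
  linarith

/-- **Stability form**: `‖e^{-F}‖_{T_φ} ≤ e^{-Re F(φ)} e^{‖F‖_{T_φ} - |F(φ)|}` for complex `F` — a large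
positive real part of `F(φ)` is not wasted. [cite: BauerschmidtBrydgesSlade2019RG, Lemma 7.4.1] -/
theorem tphiSeminorm_cexp_neg_le (N : ℕ) {𝔥 : ℝ} (h𝔥 : 0 ≤ 𝔥) {F : E → ℂ} (hF : ContDiff ℝ N F) (φ : E) :
    tphiSeminorm N 𝔥 (fun x => Complex.exp (-F x)) φ ≤
      Real.exp (-(F φ).re) * Real.exp (tphiSeminorm N 𝔥 F φ - ‖F φ‖) := by
  have h := tphiSeminorm_cexp_le N h𝔥 hF.neg φ
  rw [tphiSeminorm_neg N 𝔥 hF φ, norm_neg, Complex.neg_re] at h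
  exact h

end Tphi

end Literature.MathematicalPhysics.QuantumFieldTheory

end
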